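import Mathlib
import Literature.NumberTheory.LFunctions.Zhang2022.Section16CalM2Euler
import Literature.NumberTheory.LFunctions.Zhang2022.Section16BVarpiLocal
import Literature.NumberTheory.LFunctions.Zhang2022.TypedSection16ACalM2
import Literature.NumberTheory.LFunctions.RamanujanDivisorSquare
import HarnessLib

/-!
# Zhang (2022) §16 Lemma 16.2 at the repaired normaliser (GAP row G-d57-1), part 1: the local data
# of `E₂ⱼ(s) = (ζ(s)²ζ(s−β_j)L(s,χ)L(s−β_j,χ)²)⁻¹ Σ_n ϖ₂ⱼ(n)(ν∗χ)(n)n^{−s}` at a prime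

Topic `Literature/NumberTheory/LFunctions/Zhang2022` (Landau–Siegel audit tree; verdict-neutral).
Y. Zhang, *Discrete mean estimates and the Landau–Siegel zero*, arXiv:2211.02515v1 (2022)
[Zhang2022LandauSiegel] — **an unrefereed manuscript under adjudication; nothing here asserts or denies
its Theorems 1–2.** ZHANG-L discharge lane, WP16 block D (sub-leaf `Typed.Section16B.Lemma162R` of the
RT-03 leaf `Eq16_16R2`; the manuscript proves Lemma 16.2 by "a sketch only", App. A pp. 105–106,
tex L5225–L5237). This file supplies the arithmetic of the coefficients `ϖ₂ⱼ(n)(ν∗χ)(n)` at prime powers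
(theorems only; no definitions, no facts):

* §1 `ν∗χ` (`Typed.Section16B.nuConvChi`, (16.15)): multiplicative, `(ν∗χ)(1) = 1`, at prime powers
  `Σ_{i≤e} ν(qⁱ)χ(q)^{e−i}`, `|(ν∗χ)(q^e)| ≤ (e+1)²`, `|(ν∗χ)(n)| ≤ τ(n)²`; `(ν∗χ)(q) = 1 + 2χ(q)`;
  `(ν∗χ)(q^e) = 1` when `χ(q) = 0`;
* §2 the Euler factor `F_q(d,l;s)` of `𝓜₂(d,l;s)` (`Typed.Section16A.calM2Factor`) at `d, l` powers of `q`
  (only `[q∣d], [q∣l]` matter: `Section16CalM2Euler.calM2Factor_congr`), its closed "master form" from the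
  tree's `AppendixA.lamTilde2_prime` / `xi2LocalSeries_prime`, and the uniform bounds
  `‖F_q(d,l;s)‖ ≤ 250` (`σ ≥ 9/10`), `‖F_q(d,l;1−β_j) − 1‖ ≤ 60/q` (every prime, all `d, l`);
* §3 `ϖ₂ⱼ^loc` (`Typed.Section16B.varpi2loc`) at prime powers:
  `ϖ₂ⱼ^loc(q^e) = Σ_{a+b=e} λ₂(q)^{[a≥1]} q^{aβ_j} χ(q)^b · F_q(q^a,q^b;1−β_j)/F_q(1,1;1−β_j)`, and the bound
  `‖ϖ₂ⱼ^loc(q^e)‖ ≤ 1500(e+1)` whenever `‖F_q(1,1;1−β_j)‖ ≥ 1/2`.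

These are the inputs of the Euler product of `Σ_n ϖ₂ⱼ(n)(ν∗χ)(n)n^{−s}` (companion file
`Section16Lemma162REuler`) and of the continuation of `E₂ⱼ` to `σ > 9/10` (G-d57-1's `Lemma162R`).

## References

* Y. Zhang, arXiv:2211.02515v1 (2022), §16 pp. 90–94 ((16.7), (16.8), u021, (16.13), (16.15), Lemma 16.2),
  App. A p. 105. [cite: Zhang2022LandauSiegel, §16 Lemma 16.2 p.94]
-/

noncomputable section

open Complex Real Finset

namespace Literature.NumberTheory.LFunctions.Zhang2022.Lemma162R

open Literature.NumberTheory.LFunctions.Zhang2022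
open Literature.NumberTheory.LFunctions.Zhang2022.Skeleton
open Literature.NumberTheory.LFunctions.Zhang2022.Typed.Section16A
open Literature.NumberTheory.LFunctions.Zhang2022.Typed.Section16B
open Literature.NumberTheory.LFunctions.Zhang2022.AppendixA

/-! ## §1. The coefficient `(ν∗χ)(n)` of (16.15) -/

section NuConvChi

variable {D : ℕ} (χ : DirichletCharacter ℂ D)

/-- `(ν∗χ)(n) = Σ_{n=ab} ν(a)χ(b)` (unfolding of `Typed.Section16B.nuConvChi`).
[cite: Zhang2022LandauSiegel, §16 (16.15) p.94] -/
theorem nuConvChi_apply (n : ℕ) :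
    nuConvChi χ n = ∑ x ∈ n.divisorsAntidiagonal, nu χ x.1 * χ (x.2 : ZMod D) := by
  rw [nuConvChi, LSeries.convolution_def]

/-- `(ν∗χ)(0) = 0` (junk value). [cite: Zhang2022LandauSiegel, §16 (16.15) p.94] -/
theorem nuConvChi_zero : nuConvChi χ 0 = 0 := by
  rw [nuConvChi_apply]; simp

/-- `(ν∗χ)(1) = 1`. [cite: Zhang2022LandauSiegel, §16 (16.15) p.94] -/
theorem nuConvChi_one : nuConvChi χ 1 = 1 := by
  rw [nuConvChi_apply, Nat.divisorsAntidiagonal_one, Finset.sum_singleton]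
  simp [nu]

/-- As an arithmetic function, `ν = ζ ∗ χ` (Mathlib's `DirichletCharacter.zetaMul`).
[cite: Zhang2022LandauSiegel, §3 p.6] -/
theorem toArithmeticFunction_nu : toArithmeticFunction (nu χ) = χ.zetaMul := by
  ext n
  rcases eq_or_ne n 0 with rfl | hn
  · simp [toArithmeticFunction]
  · rw [DirichletCharacter.zetaMul]
    simp only [toArithmeticFunction, ArithmeticFunction.coe_mk, if_neg hn]
    rw [nu, Literature.NumberTheory.LFunctions.divisorSumChar_eq_zeta_mul]
    rfl

/-- **`ν∗χ` is multiplicative**: `(ν∗χ)(mn) = (ν∗χ)(m)(ν∗χ)(n)` for coprime `m, n` (`ν = ζ∗χ` and `χ`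
are multiplicative arithmetic functions). [cite: Zhang2022LandauSiegel, §16 (16.15) p.94] -/
theorem nuConvChi_mul_of_coprime {m n : ℕ} (hmn : Nat.Coprime m n) :
    nuConvChi χ (m * n) = nuConvChi χ m * nuConvChi χ n := by
  have hmul : (toArithmeticFunction (nu χ) * toArithmeticFunction (fun k : ℕ => χ (k : ZMod D))).IsMultiplicative := by
    rw [toArithmeticFunction_nu]
    exact (DirichletCharacter.isMultiplicative_zetaMul χ).mul
      (DirichletCharacter.isMultiplicative_toArithmeticFunction χ)
  have h := hmul.map_mul_of_coprime hmn
  simpa [nuConvChi, LSeries.convolution] using h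

/-- `|ν(n)| ≤ τ(n)` (`ν(n) = Σ_{d∣n} χ(d)`, `|χ| ≤ 1`). [cite: Zhang2022LandauSiegel, §3 p.6] -/
theorem norm_nu_le (n : ℕ) : ‖nu χ n‖ ≤ (n.divisors.card : ℝ) :=
  Literature.NumberTheory.LFunctions.norm_divisorSumChar_le χ n

/-- **`|(ν∗χ)(n)| ≤ τ(n)²`**: `Σ_{n=ab} |ν(a)||χ(b)| ≤ Σ_{a∣n} τ(a) ≤ τ(n)·τ(n)`.
[cite: Zhang2022LandauSiegel, §16 (16.15) p.94] -/
theorem norm_nuConvChi_le {n : ℕ} (hn : n ≠ 0) : ‖nuConvChi χ n‖ ≤ (n.divisors.card : ℝ) ^ 2 := by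
  rw [nuConvChi_apply]
  calc ‖∑ x ∈ n.divisorsAntidiagonal, nu χ x.1 * χ (x.2 : ZMod D)‖
      ≤ ∑ x ∈ n.divisorsAntidiagonal, ‖nu χ x.1 * χ (x.2 : ZMod D)‖ := norm_sum_le _ _
    _ ≤ ∑ x ∈ n.divisorsAntidiagonal, (n.divisors.card : ℝ) := by
        refine Finset.sum_le_sum fun x hx => ?_
        have hx' := Nat.mem_divisorsAntidiagonal.mp hx
        have hdvd : x.1 ∣ n := ⟨x.2, hx'.1.symm⟩
        rw [norm_mul]
        calc ‖nu χ x.1‖ * ‖χ (x.2 : ZMod D)‖ ≤ (x.1.divisors.card : ℝ) * 1 :=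
              mul_le_mul (norm_nu_le χ x.1) (χ.norm_le_one _) (norm_nonneg _) (Nat.cast_nonneg _)
          _ ≤ (n.divisors.card : ℝ) := by
              rw [mul_one]
              exact_mod_cast Finset.card_le_card (Nat.divisors_subset_of_dvd hn hdvd)
    _ = (n.divisorsAntidiagonal.card : ℝ) * n.divisors.card := by rw [Finset.sum_const, nsmul_eq_mul]
    _ = (n.divisors.card : ℝ) ^ 2 := by rw [← Nat.map_div_right_divisors, Finset.card_map]; ring

/-- **`(ν∗χ)` at a prime power**: `(ν∗χ)(q^e) = Σ_{i≤e} ν(qⁱ)χ(q)^{e−i}`.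
[cite: Zhang2022LandauSiegel, §16 (16.15) p.94] -/
theorem nuConvChi_prime_pow {q : ℕ} (hq : q.Prime) (e : ℕ) :
    nuConvChi χ (q ^ e) = ∑ i ∈ Finset.range (e + 1), nu χ (q ^ i) * χ (q : ZMod D) ^ (e - i) := by
  rw [nuConvChi_apply, Nat.sum_divisorsAntidiagonal (fun a b => nu χ a * χ (b : ZMod D)),
    Nat.divisors_prime_pow hq, Finset.sum_map]
  refine Finset.sum_congr rfl fun i hi => ?_
  have hi' : i ≤ e := Nat.lt_succ_iff.mp (Finset.mem_range.mp hi)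
  simp only [Function.Embedding.coeFn_mk]
  rw [Nat.pow_div hi' hq.pos, Nat.cast_pow, map_pow]

/-- `ν` at a prime power: `ν(qⁱ) = Σ_{t≤i} χ(q)^t`, of norm `≤ i+1`. [cite: Zhang2022LandauSiegel, §3 p.6] -/
theorem norm_nu_prime_pow_le {q : ℕ} (hq : q.Prime) (i : ℕ) : ‖nu χ (q ^ i)‖ ≤ (i : ℝ) + 1 := by
  rw [nu, Literature.NumberTheory.LFunctions.divisorSumChar_prime_pow χ hq,
    Literature.NumberTheory.LFunctions.geomPartialSum]
  calc ‖∑ j ∈ Finset.range (i + 1), χ (q : ZMod D) ^ j‖ ≤ ∑ j ∈ Finset.range (i + 1), ‖χ (q : ZMod D) ^ j‖ :=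
        norm_sum_le _ _
    _ ≤ ∑ j ∈ Finset.range (i + 1), (1 : ℝ) := Finset.sum_le_sum fun j _ => by
        rw [norm_pow]; exact pow_le_one₀ (norm_nonneg _) (χ.norm_le_one _)
    _ = (i : ℝ) + 1 := by simp

/-- **`|(ν∗χ)(q^e)| ≤ (e+1)²`**. [cite: Zhang2022LandauSiegel, §16 (16.15) p.94] -/
theorem norm_nuConvChi_prime_pow_le {q : ℕ} (hq : q.Prime) (e : ℕ) :
    ‖nuConvChi χ (q ^ e)‖ ≤ ((e : ℝ) + 1) ^ 2 := by
  rw [nuConvChi_prime_pow χ hq e]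
  calc ‖∑ i ∈ Finset.range (e + 1), nu χ (q ^ i) * χ (q : ZMod D) ^ (e - i)‖
      ≤ ∑ i ∈ Finset.range (e + 1), ‖nu χ (q ^ i) * χ (q : ZMod D) ^ (e - i)‖ := norm_sum_le _ _
    _ ≤ ∑ i ∈ Finset.range (e + 1), ((e : ℝ) + 1) := Finset.sum_le_sum fun i hi => by
        have hi' : (i : ℝ) ≤ e := by exact_mod_cast Nat.lt_succ_iff.mp (Finset.mem_range.mp hi)
        rw [norm_mul, norm_pow]
        calc ‖nu χ (q ^ i)‖ * ‖χ (q : ZMod D)‖ ^ (e - i) ≤ ((i : ℝ) + 1) * 1 :=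
              mul_le_mul (norm_nu_prime_pow_le χ hq i) (pow_le_one₀ (norm_nonneg _) (χ.norm_le_one _))
                (by positivity) (by positivity)
          _ ≤ (e : ℝ) + 1 := by linarith
    _ = ((e : ℝ) + 1) ^ 2 := by simp; ring

/-- At a prime `q` with `χ(q) = 0` (i.e. `q ∣ D`): `(ν∗χ)(q^e) = 1` (only `i = e`, `t = 0` survive).
[cite: Zhang2022LandauSiegel, §16 (16.15) p.94] -/
theorem nuConvChi_prime_pow_of_apply_eq_zero {q : ℕ} (hq : q.Prime) (hv : χ (q : ZMod D) = 0) (e : ℕ) :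
    nuConvChi χ (q ^ e) = 1 := by
  rw [nuConvChi_prime_pow χ hq e, Finset.sum_range_succ, Nat.sub_self, pow_zero, mul_one]
  have hν : ∀ i : ℕ, nu χ (q ^ i) = 1 := fun i => by
    rw [nu, Literature.NumberTheory.LFunctions.divisorSumChar_prime_pow χ hq,
      Literature.NumberTheory.LFunctions.geomPartialSum, Finset.sum_range_succ', pow_zero]
    rw [Finset.sum_eq_zero fun j _ => by rw [pow_succ, hv, mul_zero], zero_add]
  rw [hν, Finset.sum_eq_zero fun i hi => ?_, zero_add]
  have hi' : i < e := Finset.mem_range.mp hi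
  rw [hν, one_mul, show e - i = (e - i - 1) + 1 by omega, pow_succ, hv, mul_zero]

/-- At a prime `q`: `(ν∗χ)(q) = 1 + 2χ(q)` (`ν(q) = 1 + χ(q)`). [cite: Zhang2022LandauSiegel, §16 (16.15) p.94] -/
theorem nuConvChi_prime {q : ℕ} (hq : q.Prime) : nuConvChi χ q = 1 + 2 * χ (q : ZMod D) := by
  have h := nuConvChi_prime_pow χ hq 1
  rw [pow_one] at h
  rw [h, Finset.sum_range_succ, Finset.sum_range_succ, Finset.sum_range_zero, zero_add, pow_zero, pow_one,
    Nat.sub_self, pow_zero, mul_one]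
  have h1 : nu χ 1 = 1 := by rw [nu]; exact Literature.NumberTheory.LFunctions.divisorSumChar_one χ
  have hq1 : nu χ q = 1 + χ (q : ZMod D) := by
    rw [nu, show q = q ^ 1 from (pow_one q).symm,
      Literature.NumberTheory.LFunctions.divisorSumChar_prime_pow χ hq 1,
      Literature.NumberTheory.LFunctions.geomPartialSum, Finset.sum_range_succ, Finset.sum_range_succ,
      Finset.sum_range_zero, pow_zero, pow_one, zero_add, pow_one]
  simp only [pow_one] at *
  rw [h1, hq1]
  ring

end NuConvChi

/-! ## §2. The Euler factor `F_q(d,l;s)` of `𝓜₂(d,l;s)`: size bounds -/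

section Factor

variable (c' : ℝ) {D : ℕ} (χ : DirichletCharacter ℂ D)

/-- For a prime `q` and `σ ≥ 9/10`: `‖q^{−s}‖ ≤ 3/5` and `‖q^{−(s+β₁)}‖ ≤ 3/5` (`Re β₁ = 0`).
[cite: Zhang2022LandauSiegel, §16 p.91] -/
theorem norm_cpow_neg_le {q : ℕ} (hq : q.Prime) {s : ℂ} (hs : 9 / 10 ≤ s.re) :
    ‖(q : ℂ) ^ (-s)‖ ≤ 3 / 5 ∧ ‖(q : ℂ) ^ (-(s + beta1 c' D))‖ ≤ 3 / 5 := by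
  have h1 := (norm_cpow_neg_le_three_fifths hq.two_le hs).2
  have hs' : 9 / 10 ≤ (s + beta1 c' D).re := by
    rw [Complex.add_re, beta1_eq_b1_mul_I]; simp; exact hs
  exact ⟨h1, (norm_cpow_neg_le_three_fifths hq.two_le hs').2⟩

/-- At `s₀ = 1 − β_j`: `‖q^{−s₀}‖ = q⁻¹` and `‖q^{−(s₀+β₁)}‖ = q⁻¹`. [cite: Zhang2022LandauSiegel, §16 p.93] -/
theorem norm_cpow_neg_betaJ {q : ℕ} (hq : q.Prime) (j : ℕ) :
    ‖(q : ℂ) ^ (-(1 - betaJ c' D j))‖ = (q : ℝ)⁻¹ ∧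
      ‖(q : ℂ) ^ (-((1 - betaJ c' D j) + beta1 c' D))‖ = (q : ℝ)⁻¹ := by
  have h0 : (betaJ c' D j).re = 0 := betaJ_re_eq_zero c' D j
  have h1 : (beta1 c' D).re = 0 := by rw [beta1_eq_b1_mul_I]; simp
  constructor
  · rw [Complex.norm_natCast_cpow_of_pos hq.pos]; simp [h0, Real.rpow_neg_one]
  · rw [Complex.norm_natCast_cpow_of_pos hq.pos]; simp [h0, h1, Real.rpow_neg_one]

/-- **The prefactor `(1−q^{−s−β₁})/((1−q^{−s})(1−χ(q)q^{−s}))` is at most `10` in norm** for `σ ≥ 9/10`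
(numerator `≤ 8/5`, each denominator factor `≥ 2/5`). [cite: Zhang2022LandauSiegel, §16 p.91 (u021)] -/
theorem norm_pref_le {q : ℕ} (hq : q.Prime) {s : ℂ} (hs : 9 / 10 ≤ s.re) :
    ‖(1 - (q : ℂ) ^ (-(s + beta1 c' D))) / ((1 - (q : ℂ) ^ (-s)) * (1 - χ (q : ZMod D) * (q : ℂ) ^ (-s)))‖
      ≤ 10 := by
  obtain ⟨hx, ha⟩ := norm_cpow_neg_le c' (D := D) hq hs
  have hv : ‖χ (q : ZMod D)‖ ≤ 1 := χ.norm_le_one _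
  have hnum : ‖1 - (q : ℂ) ^ (-(s + beta1 c' D))‖ ≤ 8 / 5 := by
    calc _ ≤ ‖(1 : ℂ)‖ + ‖(q : ℂ) ^ (-(s + beta1 c' D))‖ := norm_sub_le _ _
      _ ≤ 8 / 5 := by rw [norm_one]; linarith
  have hd1 : 2 / 5 ≤ ‖1 - (q : ℂ) ^ (-s)‖ := by
    have := norm_sub_norm_le (1 : ℂ) ((q : ℂ) ^ (-s)); rw [norm_one] at this; linarith
  have hd2 : 2 / 5 ≤ ‖1 - χ (q : ZMod D) * (q : ℂ) ^ (-s)‖ := by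
    have h := norm_sub_norm_le (1 : ℂ) (χ (q : ZMod D) * (q : ℂ) ^ (-s))
    rw [norm_one, norm_mul] at h
    nlinarith [norm_nonneg (χ (q : ZMod D)), norm_nonneg ((q : ℂ) ^ (-s))]
  have hden : 4 / 25 ≤ ‖(1 - (q : ℂ) ^ (-s)) * (1 - χ (q : ZMod D) * (q : ℂ) ^ (-s))‖ := by
    rw [norm_mul]; nlinarith
  rw [norm_div, div_le_iff₀ (by linarith)]
  linarith

/-- **At `s₀ = 1 − β_j` the prefactor is `1 + O(q⁻¹)`**: `‖pref − 1‖ ≤ 14/q`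
(`pref − 1 = (x + χx − a − χx²)/((1−x)(1−χx))` with `|x| = |a| = q⁻¹`). [cite: Zhang2022LandauSiegel, §16 p.93] -/
theorem norm_pref_betaJ_sub_one_le {q : ℕ} (hq : q.Prime) (j : ℕ) :
    ‖(1 - (q : ℂ) ^ (-((1 - betaJ c' D j) + beta1 c' D))) /
          ((1 - (q : ℂ) ^ (-(1 - betaJ c' D j))) * (1 - χ (q : ZMod D) * (q : ℂ) ^ (-(1 - betaJ c' D j)))) - 1‖
      ≤ 14 / q := by
  obtain ⟨hx, ha⟩ := norm_cpow_neg_betaJ c' (D := D) hq j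
  set x : ℂ := (q : ℂ) ^ (-(1 - betaJ c' D j)) with hxdef
  set a : ℂ := (q : ℂ) ^ (-((1 - betaJ c' D j) + beta1 c' D)) with hadef
  set v : ℂ := χ (q : ZMod D) with hvdef
  have hv : ‖v‖ ≤ 1 := χ.norm_le_one _
  have hq2 : (2 : ℝ) ≤ q := by exact_mod_cast hq.two_le
  have hq0 : (0 : ℝ) < q := by linarith
  have hqinv : (q : ℝ)⁻¹ ≤ 1 / 2 := inv_le_of_inv_le₀ (by norm_num) (by linarith)
  have hd1 : 1 / 2 ≤ ‖1 - x‖ := by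
    have := norm_sub_norm_le (1 : ℂ) x; rw [norm_one] at this; linarith
  have hd2 : 1 / 2 ≤ ‖1 - v * x‖ := by
    have h := norm_sub_norm_le (1 : ℂ) (v * x)
    rw [norm_one, norm_mul] at h
    nlinarith [norm_nonneg v, norm_nonneg x]
  have hden0 : (1 - x) * (1 - v * x) ≠ 0 := by
    intro h0
    have : ‖(1 - x) * (1 - v * x)‖ = 0 := by rw [h0, norm_zero]
    rw [norm_mul] at this
    nlinarith
  have e : (1 - a) / ((1 - x) * (1 - v * x)) - 1 = (x + v * x - a - v * x ^ 2) / ((1 - x) * (1 - v * x)) := by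
    rw [div_sub_one hden0]
    congr 1
    ring
  rw [e, norm_div, norm_mul]
  have hnum : ‖x + v * x - a - v * x ^ 2‖ ≤ 7 / 2 * (q : ℝ)⁻¹ := by
    have t1 : ‖v * x‖ ≤ (q : ℝ)⁻¹ := by rw [norm_mul]; nlinarith [norm_nonneg v, norm_nonneg x]
    have t2 : ‖v * x ^ 2‖ ≤ (q : ℝ)⁻¹ * (1 / 2) := by
      rw [norm_mul, norm_pow, hx]
      calc ‖v‖ * (q : ℝ)⁻¹ ^ 2 ≤ 1 * (q : ℝ)⁻¹ ^ 2 := by gcongr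
        _ = (q : ℝ)⁻¹ * (q : ℝ)⁻¹ := by ring
        _ ≤ (q : ℝ)⁻¹ * (1 / 2) := by gcongr
    calc ‖x + v * x - a - v * x ^ 2‖ ≤ ‖x‖ + ‖v * x‖ + ‖a‖ + ‖v * x ^ 2‖ := by
          have h1 := norm_add_le (x + v * x - a) (-(v * x ^ 2))
          have h2 := norm_sub_le (x + v * x) a
          have h3 := norm_add_le x (v * x)
          rw [norm_neg] at h1
          rw [show x + v * x - a - v * x ^ 2 = x + v * x - a + -(v * x ^ 2) by ring]
          linarith
      _ ≤ 7 / 2 * (q : ℝ)⁻¹ := by rw [hx, ha]; linarith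
  rw [div_le_div_iff₀ (by positivity) hq0]
  calc ‖x + v * x - a - v * x ^ 2‖ * q ≤ 7 / 2 * (q : ℝ)⁻¹ * q := by gcongr
    _ = 7 / 2 := by field_simp
    _ ≤ 14 * (‖1 - x‖ * ‖1 - v * x‖) := by nlinarith

/-- **`‖λ̃₂(q,d)‖ ≤ 3`** at a prime (`λ̃₂(q,d) ∈ {λ₂(q), 1}`, `|λ₂(q)| ≤ (1+½)/(1−½)`).
[cite: Zhang2022LandauSiegel, §16 (16.8) p.91] -/
theorem norm_lamTilde2_le {q : ℕ} (hq : q.Prime) (d : ℕ) : ‖lamTilde2 c' χ q d‖ ≤ 3 := by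
  rw [lamTilde2_prime c' χ hq d]
  split_ifs
  · unfold locLam
    have hq2 : (2 : ℝ) ≤ q := by exact_mod_cast hq.two_le
    have hq0 : (0 : ℝ) < q := by linarith
    obtain ⟨hw, -⟩ := norm_cpow_neg_beta1 c' (D := D) hq.pos
    have hv : ‖χ (q : ZMod D)‖ ≤ 1 := χ.norm_le_one _
    have hvq : ‖χ (q : ZMod D) / (q : ℂ)‖ ≤ 1 / 2 := by
      rw [norm_div, Complex.norm_natCast]
      calc ‖χ (q : ZMod D)‖ / q ≤ 1 / q := by gcongr
        _ ≤ 1 / 2 := one_div_le_one_div_of_le (by norm_num) hq2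
    have hvwq : ‖χ (q : ZMod D) * (q : ℂ) ^ (-beta1 c' D) / (q : ℂ)‖ ≤ 1 / 2 := by
      rw [norm_div, norm_mul, hw, mul_one, Complex.norm_natCast]
      calc ‖χ (q : ZMod D)‖ / q ≤ 1 / q := by gcongr
        _ ≤ 1 / 2 := one_div_le_one_div_of_le (by norm_num) hq2
    have hnum : ‖1 - χ (q : ZMod D) * (q : ℂ) ^ (-beta1 c' D) / (q : ℂ)‖ ≤ 3 / 2 := by
      calc _ ≤ ‖(1 : ℂ)‖ + ‖χ (q : ZMod D) * (q : ℂ) ^ (-beta1 c' D) / (q : ℂ)‖ := norm_sub_le _ _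
        _ ≤ 3 / 2 := by rw [norm_one]; linarith
    have hden : 1 / 2 ≤ ‖1 - χ (q : ZMod D) / (q : ℂ)‖ := by
      have := norm_sub_norm_le (1 : ℂ) (χ (q : ZMod D) / (q : ℂ)); rw [norm_one] at this; linarith
    rw [norm_div, div_le_iff₀ (by linarith)]
    linarith
  · rw [norm_one]; norm_num

/-- **The local series `Σ_{r≥1} ξ₂(qʳ;d,l)q^{−rs}` is at most `11` in norm** for `σ ≥ 9/10` (closed form
`AppendixA.xi2LocalSeries_prime`: `c_d(w−1)x/(1−wx) − [q∤l](χ(q)q/(q−1))x(1−x)/(1−wx)` with `|x| ≤ 3/5`,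
`|w| = 1`, `|c_d| ≤ 2`). [cite: Zhang2022LandauSiegel, §16 p.91, App. A p.105] -/
theorem norm_xi2LocalSeries_le {q : ℕ} (hq : q.Prime) (d l : ℕ) {s : ℂ} (hs : 9 / 10 ≤ s.re) :
    ‖xi2LocalSeries c' χ q d l s‖ ≤ 11 := by
  obtain ⟨hx, -⟩ := norm_cpow_neg_le c' (D := D) hq hs
  have hx1 : ‖(q : ℂ) ^ (-s)‖ < 1 := by linarith
  obtain ⟨hw, -⟩ := norm_cpow_neg_beta1 c' (D := D) hq.pos
  rw [xi2LocalSeries_prime c' χ hq d l s hx1]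
  set x : ℂ := (q : ℂ) ^ (-s) with hxdef
  set w : ℂ := (q : ℂ) ^ (-beta1 c' D) with hwdef
  set v : ℂ := χ (q : ZMod D) with hvdef
  have hv : ‖v‖ ≤ 1 := χ.norm_le_one _
  have hq2 : (2 : ℝ) ≤ q := by exact_mod_cast hq.two_le
  have hq0 : (0 : ℝ) < q := by linarith
  -- the constants
  have hcd : ‖(if Nat.Coprime q d then (1 - w * (v / q))⁻¹ else (1 : ℂ))‖ ≤ 2 := by
    split_ifs
    · have h1 : ‖w * (v / q)‖ ≤ 1 / 2 := by
        rw [norm_mul, hw, one_mul, norm_div, Complex.norm_natCast]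
        calc ‖v‖ / q ≤ 1 / q := by gcongr
          _ ≤ 1 / 2 := one_div_le_one_div_of_le (by norm_num) hq2
      have h2 : 1 / 2 ≤ ‖1 - w * (v / q)‖ := by
        have := norm_sub_norm_le (1 : ℂ) (w * (v / q)); rw [norm_one] at this; linarith
      rw [norm_inv]; exact inv_le_of_inv_le₀ (by norm_num) (by linarith)
    · rw [norm_one]; norm_num
  have hel : ‖(if Nat.Coprime q l then (1 : ℂ) else 0)‖ ≤ 1 := by split_ifs <;> simp
  have hvq : ‖v * (q : ℂ) / ((q : ℂ) - 1)‖ ≤ 2 := by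
    have hq1 : 1 ≤ ‖(q : ℂ) - 1‖ := by
      have := norm_sub_norm_le (q : ℂ) 1; rw [Complex.norm_natCast, norm_one] at this; linarith
    rw [norm_div, norm_mul, Complex.norm_natCast, div_le_iff₀ (by linarith)]
    have : ‖(q : ℂ) - 1‖ ≥ (q : ℝ) - 1 := by
      have := norm_sub_norm_le (q : ℂ) 1; rw [Complex.norm_natCast, norm_one] at this; linarith
    nlinarith [norm_nonneg v]
  have hwx : 2 / 5 ≤ ‖1 - w * x‖ := by
    have h := norm_sub_norm_le (1 : ℂ) (w * x); rw [norm_one, norm_mul, hw, one_mul] at h; linarith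
  have hw1 : ‖w - 1‖ ≤ 2 := by
    calc ‖w - 1‖ ≤ ‖w‖ + ‖(1 : ℂ)‖ := norm_sub_le _ _
      _ = 2 := by rw [hw, norm_one]; norm_num
  -- term 1: `c_d (w−1) x/(1−wx)`
  have t1 : ‖(if Nat.Coprime q d then (1 - w * (v / q))⁻¹ else (1 : ℂ)) * (w - 1) * x / (1 - w * x)‖ ≤ 6 := by
    rw [norm_div, norm_mul, norm_mul, div_le_iff₀ (by linarith)]
    calc ‖(if Nat.Coprime q d then (1 - w * (v / q))⁻¹ else (1 : ℂ))‖ * ‖w - 1‖ * ‖x‖ ≤ 2 * 2 * (3 / 5) := by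
          gcongr
      _ ≤ 6 * ‖1 - w * x‖ := by linarith
  -- term 2: `[q∤l] (vq/(q−1)) x(1−x)/(1−wx)`
  have t2 : ‖(if Nat.Coprime q l then (1 : ℂ) else 0) * (v * (q : ℂ) / ((q : ℂ) - 1)) *
      (x * (1 - x) / (1 - w * x))‖ ≤ 5 := by
    have h1x : ‖1 - x‖ ≤ 8 / 5 := by
      calc ‖1 - x‖ ≤ ‖(1 : ℂ)‖ + ‖x‖ := norm_sub_le _ _
        _ ≤ 8 / 5 := by rw [norm_one]; linarith
    have hfrac : ‖x * (1 - x) / (1 - w * x)‖ ≤ 12 / 5 := by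
      rw [norm_div, norm_mul, div_le_iff₀ (by linarith)]
      calc ‖x‖ * ‖1 - x‖ ≤ (3 / 5) * (8 / 5) := by gcongr
        _ ≤ 12 / 5 * ‖1 - w * x‖ := by linarith
    rw [norm_mul, norm_mul]
    calc ‖(if Nat.Coprime q l then (1 : ℂ) else 0)‖ * ‖v * (q : ℂ) / ((q : ℂ) - 1)‖ *
          ‖x * (1 - x) / (1 - w * x)‖ ≤ 1 * 2 * (12 / 5) := by gcongr
      _ ≤ 5 := by norm_num
  calc _ ≤ ‖(if Nat.Coprime q d then (1 - w * (v / q))⁻¹ else (1 : ℂ)) * (w - 1) * x / (1 - w * x)‖ +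
        ‖(if Nat.Coprime q l then (1 : ℂ) else 0) * (v * (q : ℂ) / ((q : ℂ) - 1)) *
          (x * (1 - x) / (1 - w * x))‖ := norm_sub_le _ _
    _ ≤ 11 := by linarith

/-- **At `s₀ = 1 − β_j` the local series is `O(q⁻¹)`**: `‖Σ_{r≥1} ξ₂(qʳ;d,l)q^{−rs₀}‖ ≤ 14/q`
(`|x₀| = q⁻¹`). [cite: Zhang2022LandauSiegel, §16 p.93, App. A p.105] -/
theorem norm_xi2LocalSeries_betaJ_le {q : ℕ} (hq : q.Prime) (d l : ℕ) (j : ℕ) :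
    ‖xi2LocalSeries c' χ q d l (1 - betaJ c' D j)‖ ≤ 14 / q := by
  obtain ⟨hx, -⟩ := norm_cpow_neg_betaJ c' (D := D) hq j
  have hq2 : (2 : ℝ) ≤ q := by exact_mod_cast hq.two_le
  have hq0 : (0 : ℝ) < q := by linarith
  have hqinv : (q : ℝ)⁻¹ ≤ 1 / 2 := inv_le_of_inv_le₀ (by norm_num) (by linarith)
  have hx1 : ‖(q : ℂ) ^ (-(1 - betaJ c' D j))‖ < 1 := by rw [hx]; linarith
  obtain ⟨hw, -⟩ := norm_cpow_neg_beta1 c' (D := D) hq.pos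
  rw [xi2LocalSeries_prime c' χ hq d l _ hx1]
  set x : ℂ := (q : ℂ) ^ (-(1 - betaJ c' D j)) with hxdef
  set w : ℂ := (q : ℂ) ^ (-beta1 c' D) with hwdef
  set v : ℂ := χ (q : ZMod D) with hvdef
  have hv : ‖v‖ ≤ 1 := χ.norm_le_one _
  have hcd : ‖(if Nat.Coprime q d then (1 - w * (v / q))⁻¹ else (1 : ℂ))‖ ≤ 2 := by
    split_ifs
    · have h1 : ‖w * (v / q)‖ ≤ 1 / 2 := by
        rw [norm_mul, hw, one_mul, norm_div, Complex.norm_natCast]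
        calc ‖v‖ / q ≤ 1 / q := by gcongr
          _ ≤ 1 / 2 := one_div_le_one_div_of_le (by norm_num) hq2
      have h2 : 1 / 2 ≤ ‖1 - w * (v / q)‖ := by
        have := norm_sub_norm_le (1 : ℂ) (w * (v / q)); rw [norm_one] at this; linarith
      rw [norm_inv]; exact inv_le_of_inv_le₀ (by norm_num) (by linarith)
    · rw [norm_one]; norm_num
  have hel : ‖(if Nat.Coprime q l then (1 : ℂ) else 0)‖ ≤ 1 := by split_ifs <;> simp
  have hvq : ‖v * (q : ℂ) / ((q : ℂ) - 1)‖ ≤ 2 := by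
    have hq1 : (q : ℝ) - 1 ≤ ‖(q : ℂ) - 1‖ := by
      have := norm_sub_norm_le (q : ℂ) 1; rw [Complex.norm_natCast, norm_one] at this; linarith
    rw [norm_div, norm_mul, Complex.norm_natCast, div_le_iff₀ (by linarith)]
    nlinarith [norm_nonneg v]
  have hwx : 1 / 2 ≤ ‖1 - w * x‖ := by
    have h := norm_sub_norm_le (1 : ℂ) (w * x); rw [norm_one, norm_mul, hw, one_mul] at h; linarith
  have hw1 : ‖w - 1‖ ≤ 2 := by
    calc ‖w - 1‖ ≤ ‖w‖ + ‖(1 : ℂ)‖ := norm_sub_le _ _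
      _ = 2 := by rw [hw, norm_one]; norm_num
  have t1 : ‖(if Nat.Coprime q d then (1 - w * (v / q))⁻¹ else (1 : ℂ)) * (w - 1) * x / (1 - w * x)‖ ≤
      8 / q := by
    rw [norm_div, norm_mul, norm_mul, div_le_div_iff₀ (by linarith) hq0, hx]
    calc ‖(if Nat.Coprime q d then (1 - w * (v / q))⁻¹ else (1 : ℂ))‖ * ‖w - 1‖ * (q : ℝ)⁻¹ * q
        ≤ 2 * 2 * (q : ℝ)⁻¹ * q := by gcongr
      _ = 4 := by rw [show (2 : ℝ) * 2 * (q : ℝ)⁻¹ * q = 4 * ((q : ℝ)⁻¹ * q) by ring,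
          inv_mul_cancel₀ hq0.ne', mul_one]
      _ ≤ 8 * ‖1 - w * x‖ := by linarith
  have t2 : ‖(if Nat.Coprime q l then (1 : ℂ) else 0) * (v * (q : ℂ) / ((q : ℂ) - 1)) *
      (x * (1 - x) / (1 - w * x))‖ ≤ 6 / q := by
    have h1x : ‖1 - x‖ ≤ 3 / 2 := by
      calc ‖1 - x‖ ≤ ‖(1 : ℂ)‖ + ‖x‖ := norm_sub_le _ _
        _ ≤ 3 / 2 := by rw [norm_one]; linarith
    have hfrac : ‖x * (1 - x) / (1 - w * x)‖ ≤ 3 / q := by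
      rw [norm_div, norm_mul, div_le_div_iff₀ (by linarith) hq0, hx]
      calc (q : ℝ)⁻¹ * ‖1 - x‖ * q ≤ (q : ℝ)⁻¹ * (3 / 2) * q := by gcongr
        _ = 3 / 2 := by rw [show (q : ℝ)⁻¹ * (3 / 2) * q = 3 / 2 * ((q : ℝ)⁻¹ * q) by ring,
            inv_mul_cancel₀ hq0.ne', mul_one]
        _ ≤ 3 * ‖1 - w * x‖ := by linarith
    rw [norm_mul, norm_mul]
    calc ‖(if Nat.Coprime q l then (1 : ℂ) else 0)‖ * ‖v * (q : ℂ) / ((q : ℂ) - 1)‖ *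
          ‖x * (1 - x) / (1 - w * x)‖ ≤ 1 * 2 * (3 / q) := by gcongr
      _ = 6 / q := by ring
  calc _ ≤ ‖(if Nat.Coprime q d then (1 - w * (v / q))⁻¹ else (1 : ℂ)) * (w - 1) * x / (1 - w * x)‖ +
        ‖(if Nat.Coprime q l then (1 : ℂ) else 0) * (v * (q : ℂ) / ((q : ℂ) - 1)) *
          (x * (1 - x) / (1 - w * x))‖ := norm_sub_le _ _
    _ ≤ 8 / q + 6 / q := add_le_add t1 t2
    _ = 14 / q := by ring

/-- **`‖F_q(d,l;s)‖ ≤ 350` for every prime `q`, all `d, l` and `σ ≥ 9/10`** (`F_q = pref·(1 + λ̃₂·Σ)`,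
`10·(1 + 3·11)`). [cite: Zhang2022LandauSiegel, §16 p.91 (u021)] -/
theorem norm_calM2Factor_le {q : ℕ} (hq : q.Prime) (d l : ℕ) {s : ℂ} (hs : 9 / 10 ≤ s.re) :
    ‖calM2Factor c' χ q d l s‖ ≤ 350 := by
  unfold calM2Factor
  rw [norm_mul]
  have h1 := norm_pref_le c' χ hq hs
  have h2 : ‖1 + lamTilde2 c' χ q d * xi2LocalSeries c' χ q d l s‖ ≤ 34 := by
    calc _ ≤ ‖(1 : ℂ)‖ + ‖lamTilde2 c' χ q d * xi2LocalSeries c' χ q d l s‖ := norm_add_le _ _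
      _ ≤ 1 + 3 * 11 := by
          rw [norm_one, norm_mul]
          exact add_le_add le_rfl (mul_le_mul (norm_lamTilde2_le c' χ hq d)
            (norm_xi2LocalSeries_le c' χ hq d l hs) (norm_nonneg _) (by norm_num))
      _ = 34 := by norm_num
  calc _ ≤ 10 * 34 := mul_le_mul h1 h2 (norm_nonneg _) (by norm_num)
    _ ≤ 350 := by norm_num

/-- **`‖F_q(d,l;1−β_j) − 1‖ ≤ 350/q` for every prime `q` and all `d, l`** (`pref = 1 + O(q⁻¹)`, the local
series is `O(q⁻¹)`). [cite: Zhang2022LandauSiegel, §16 p.93, App. A p.105] -/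
theorem norm_calM2Factor_betaJ_sub_one_le {q : ℕ} (hq : q.Prime) (d l : ℕ) (j : ℕ) :
    ‖calM2Factor c' χ q d l (1 - betaJ c' D j) - 1‖ ≤ 350 / q := by
  have hq2 : (2 : ℝ) ≤ q := by exact_mod_cast hq.two_le
  have hq0 : (0 : ℝ) < q := by linarith
  unfold calM2Factor
  set P : ℂ := (1 - (q : ℂ) ^ (-((1 - betaJ c' D j) + beta1 c' D))) /
    ((1 - (q : ℂ) ^ (-(1 - betaJ c' D j))) * (1 - χ (q : ZMod D) * (q : ℂ) ^ (-(1 - betaJ c' D j))))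
    with hP
  set Y : ℂ := lamTilde2 c' χ q d * xi2LocalSeries c' χ q d l (1 - betaJ c' D j) with hY
  have hP1 : ‖P - 1‖ ≤ 14 / q := norm_pref_betaJ_sub_one_le c' χ hq j
  have hYb : ‖Y‖ ≤ 42 / q := by
    rw [hY, norm_mul]
    calc ‖lamTilde2 c' χ q d‖ * ‖xi2LocalSeries c' χ q d l (1 - betaJ c' D j)‖ ≤ 3 * (14 / (q : ℝ)) :=
          mul_le_mul (norm_lamTilde2_le c' χ hq d)
            (norm_xi2LocalSeries_betaJ_le c' χ hq d l j) (norm_nonneg _) (by norm_num)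
      _ = 42 / q := by ring
  have h42 : (42 : ℝ) / q ≤ 21 := by rw [div_le_iff₀ hq0]; linarith
  have e : P * (1 + Y) - 1 = (P - 1) * (1 + Y) + Y := by ring
  rw [e]
  calc ‖(P - 1) * (1 + Y) + Y‖ ≤ ‖P - 1‖ * ‖1 + Y‖ + ‖Y‖ := by
        rw [← norm_mul]; exact norm_add_le _ _
    _ ≤ (14 / q) * (1 + 42 / q) + 42 / q := by
        have h1Y : ‖1 + Y‖ ≤ 1 + 42 / q := by
          calc ‖1 + Y‖ ≤ ‖(1 : ℂ)‖ + ‖Y‖ := norm_add_le _ _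
            _ ≤ 1 + 42 / q := by rw [norm_one]; linarith
        have := mul_le_mul hP1 h1Y (norm_nonneg _) (by positivity)
        linarith
    _ ≤ (14 / q) * 22 + 42 / q := by gcongr; linarith
    _ = 350 / q := by ring

/-- **`F_q(d,l;1−β_j) ≠ 0` and `‖F_q(d,l;1−β_j)‖ ≥ 1/2` for every prime `q ≥ 700`** and all `d, l`.
[cite: Zhang2022LandauSiegel, §16 p.93] -/
theorem half_le_norm_calM2Factor_betaJ_of_le {q : ℕ} (hq : q.Prime) (h700 : 700 ≤ q) (d l : ℕ)
    (j : ℕ) : 1 / 2 ≤ ‖calM2Factor c' χ q d l (1 - betaJ c' D j)‖ := by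
  have h := norm_calM2Factor_betaJ_sub_one_le c' χ hq d l j
  have hq0 : (0 : ℝ) < q := by exact_mod_cast hq.pos
  have h700' : (700 : ℝ) ≤ q := by exact_mod_cast h700
  have h1 : (350 : ℝ) / q ≤ 1 / 2 := by rw [div_le_iff₀ hq0]; linarith
  have := norm_sub_norm_le (calM2Factor c' χ q d l (1 - betaJ c' D j)) 1
  have h2 : ‖calM2Factor c' χ q d l (1 - betaJ c' D j) - 1‖ =
      ‖1 - calM2Factor c' χ q d l (1 - betaJ c' D j)‖ := norm_sub_rev _ _
  have := norm_sub_norm_le (1 : ℂ) (calM2Factor c' χ q d l (1 - betaJ c' D j))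
  rw [norm_one] at this
  linarith

/-- **The generic factor at a SMALL prime: `‖F_q(1,1;1−β_j)‖ ≥ 1/2` for every odd prime `q < 700`, and
for `q = 2` when `χ(2) ≠ 1`**, provided `|b₁| ≤ 10⁻⁴` and `‖β_j‖ ≤ 10⁻⁴` (true for all large `D`): the factor
is within `150(|b₁| + |β_j|)log q/q²` of the main term `M_q = (1 − χ(q)/(q−1))/(1 − χ(q)/q)`
(`AppendixA.norm_locF_sub_locMain_le`), and `|M_q| ≥ 3/4` unless `q = 2`, `χ(2) = 1` (where `M₂ = 0`).
[cite: Zhang2022LandauSiegel, §16 p.93, App. A p.105] -/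
theorem half_le_norm_calM2Factor_one_one_small {q : ℕ} (hq : q.Prime) (hlt : q < 700)
    (h2 : q = 2 → χ (2 : ZMod D) ≠ 1) (hχq : χ.IsQuadratic) {j : ℕ}
    (hb1 : |b1 c' D| ≤ 1 / 10000) (hbj : ‖betaJ c' D j‖ ≤ 1 / 10000) :
    1 / 2 ≤ ‖calM2Factor c' χ q 1 1 (1 - betaJ c' D j)‖ := by
  have hq2 : (2 : ℝ) ≤ q := by exact_mod_cast hq.two_le
  have hq0 : (0 : ℝ) < q := by linarith
  have hqC : (q : ℂ) ≠ 0 := by exact_mod_cast hq.ne_zero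
  obtain ⟨hx, -⟩ := norm_cpow_neg_betaJ c' (D := D) hq j
  have hx1 : ‖(q : ℂ) ^ (-(1 - betaJ c' D j))‖ < 1 := by
    rw [hx]; exact inv_lt_one_of_one_lt₀ (by exact_mod_cast hq.one_lt)
  rw [calM2Factor_prime_one_one c' χ hq _ hx1]
  obtain ⟨hw, hw1⟩ := norm_cpow_neg_beta1 c' (D := D) hq.pos
  set v : ℂ := χ (q : ZMod D) with hvdef
  have hv : ‖v‖ ≤ 1 := χ.norm_le_one _
  -- `q·x₀ = q^{β_j}`, within `|β_j| log q` of `1`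
  have hqx : (q : ℂ) * (q : ℂ) ^ (-(1 - betaJ c' D j)) = (q : ℂ) ^ (betaJ c' D j) := by
    rw [show -(1 - betaJ c' D j) = betaJ c' D j - 1 by ring, Complex.cpow_sub _ _ hqC, Complex.cpow_one]
    field_simp
  have hlogq : Real.log q ≤ 7 := by
    have h700 : (q : ℝ) < 700 := by exact_mod_cast hlt
    have := Real.log_le_log hq0 h700.le
    have h7 : Real.log 700 ≤ 7 := by
      rw [Real.log_le_iff_le_exp (by norm_num)]
      have h1 : (2.7 : ℝ) ≤ Real.exp 1 := by linarith [Real.exp_one_gt_d9]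
      have h7 : (2.7 : ℝ) ^ 7 ≤ Real.exp 1 ^ 7 := pow_le_pow_left₀ (by norm_num) h1 7
      have he : Real.exp 7 = Real.exp 1 ^ 7 := by rw [← Real.exp_nat_mul]; norm_num
      rw [he]; nlinarith
    linarith
  have hlog0 : 0 ≤ Real.log q := Real.log_nonneg (by linarith)
  have hbj' : ‖(q : ℂ) ^ (betaJ c' D j) - 1‖ ≤ ‖betaJ c' D j‖ * Real.log q := by
    have h0 : (betaJ c' D j).re = 0 := betaJ_re_eq_zero c' D j
    set b : ℝ := (betaJ c' D j).im with hb
    have him : betaJ c' D j = (b : ℂ) * I := by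
      apply Complex.ext <;> simp [h0, hb]
    have hnb : ‖betaJ c' D j‖ = |b| := by rw [him]; simp
    have hexp : (q : ℂ) ^ (betaJ c' D j) = Complex.exp (I * ((b * Real.log q : ℝ) : ℂ)) := by
      rw [Complex.cpow_def_of_ne_zero hqC, ← Complex.natCast_log, him]
      congr 1
      push_cast
      ring
    rw [hexp, hnb]
    calc _ ≤ ‖((b * Real.log q : ℝ))‖ := Real.norm_exp_I_mul_ofReal_sub_one_le
      _ = |b| * Real.log q := by rw [Real.norm_eq_abs, abs_mul, abs_of_nonneg hlog0]
  have hqxn : ‖(q : ℂ) * (q : ℂ) ^ (-(1 - betaJ c' D j))‖ ≤ 2 := by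
    rw [hqx, Complex.norm_natCast_cpow_of_pos hq.pos, betaJ_re_eq_zero, Real.rpow_zero]; norm_num
  have hxle : ‖(q : ℂ) ^ (-(1 - betaJ c' D j))‖ ≤ 3 / 5 := by
    have hqinv : (q : ℝ)⁻¹ ≤ 1 / 2 := inv_le_of_inv_le₀ (by norm_num) (by linarith)
    rw [hx]; linarith
  have hmain := norm_locF_sub_locMain_le hv hw.le hxle hqxn hq.two_le
  -- the deviation is tiny
  have hdev : 150 * (‖(q : ℂ) ^ (-beta1 c' D) - 1‖ + ‖1 - (q : ℂ) * (q : ℂ) ^ (-(1 - betaJ c' D j))‖) /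
      (q : ℝ) ^ 2 ≤ 1 / 4 := by
    have e1 : ‖1 - (q : ℂ) * (q : ℂ) ^ (-(1 - betaJ c' D j))‖ ≤ 7 / 10000 := by
      rw [hqx, norm_sub_rev]
      calc _ ≤ ‖betaJ c' D j‖ * Real.log q := hbj'
        _ ≤ (1 / 10000) * 7 := mul_le_mul hbj hlogq hlog0 (by norm_num)
        _ = 7 / 10000 := by norm_num
    have e2 : ‖(q : ℂ) ^ (-beta1 c' D) - 1‖ ≤ 7 / 10000 := by
      calc _ ≤ |b1 c' D| * Real.log q := hw1
        _ ≤ (1 / 10000) * 7 := mul_le_mul hb1 hlogq hlog0 (by norm_num)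
        _ = 7 / 10000 := by norm_num
    have hq4 : (4 : ℝ) ≤ (q : ℝ) ^ 2 := by nlinarith
    rw [div_le_iff₀ (by positivity)]
    nlinarith
  -- the main term is at least `3/4`
  have hM : 3 / 4 ≤ ‖locMain v q‖ := by
    unfold locMain
    rcases hχq (q : ZMod D) with h0 | h1 | hm1
    · rw [← hvdef] at h0
      rw [h0]; norm_num
    · rw [← hvdef] at h1
      -- `v = 1`: then `q ≠ 2`, so `q ≥ 3`
      have hne : q ≠ 2 := by
        rintro rfl
        exact h2 rfl (by simpa [hvdef] using h1)
      have hq3 : (3 : ℝ) ≤ q := by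
        have := hq.two_le
        exact_mod_cast (show 3 ≤ q by omega)
      rw [h1]
      have e : (1 - 1 / ((q : ℂ) - 1)) / (1 - 1 / (q : ℂ)) = (((q : ℝ) - 2) * q / ((q - 1) * (q - 1)) : ℝ) := by
        have hq1 : (q : ℂ) - 1 ≠ 0 := by
          intro h; have := congrArg Complex.re h; simp at this; linarith
        push_cast
        field_simp
        ring
      have hnn : 0 ≤ ((q : ℝ) - 2) * q / ((q - 1) * (q - 1)) :=
        div_nonneg (mul_nonneg (by linarith) hq0.le) (mul_nonneg (by linarith) (by linarith))
      rw [e, Complex.norm_real, Real.norm_eq_abs, abs_of_nonneg hnn, le_div_iff₀ (by nlinarith)]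
      nlinarith
    · rw [← hvdef] at hm1
      rw [hm1]
      have e : (1 - (-1) / ((q : ℂ) - 1)) / (1 - (-1) / (q : ℂ)) = (((q : ℝ) * q) / ((q - 1) * (q + 1)) : ℝ) := by
        have hq1 : (q : ℂ) - 1 ≠ 0 := by
          intro h; have := congrArg Complex.re h; simp at this; linarith
        push_cast
        field_simp
        ring
      have hnn : 0 ≤ ((q : ℝ) * q) / ((q - 1) * (q + 1)) :=
        div_nonneg (mul_nonneg hq0.le hq0.le) (mul_nonneg (by linarith) (by linarith))
      rw [e, Complex.norm_real, Real.norm_eq_abs, abs_of_nonneg hnn, le_div_iff₀ (by nlinarith)]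
      nlinarith
  have := norm_sub_norm_le (locMain v q)
    (locF v ((q : ℂ) ^ (-beta1 c' D)) ((q : ℂ) ^ (-(1 - betaJ c' D j))) q)
  rw [norm_sub_rev] at this
  linarith

end Factor

/-! ## §3. `ϖ₂ⱼ^loc` at prime powers -/

section VarpiLoc

variable (c' : ℝ) {D : ℕ} [NeZero D] (χ : DirichletCharacter ℂ D)

omit [NeZero D] in
/-- `λ₂(q^a) = λ₂(q)` for `a ≥ 1` and `λ₂(1) = 1` (`λ₂(n,s) = ∏_{q∣n}`). [cite: Zhang2022LandauSiegel, §16 p.90 (u014)] -/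
theorem lam2_prime_pow {q : ℕ} (hq : q.Prime) (a : ℕ) (s : ℂ) :
    lam2 c' χ (q ^ a) s = if a = 0 then 1 else lam2 c' χ q s := by
  split_ifs with ha
  · rw [ha, pow_zero]; unfold lam2; rw [Nat.primeFactors_one, Finset.prod_empty]
  · unfold lam2; rw [Nat.primeFactors_prime_pow ha hq, hq.primeFactors]

omit [NeZero D] in
/-- **`ϖ₂ⱼ^loc` at a prime power**: for `e ≥ 1`,
`ϖ₂ⱼ^loc(q^e) = Σ_{a≤e} λ₂(q^a)(q^a)^{β_j}χ(q)^{e−a}·F_q(q^a,q^{e−a};1−β_j)/F_q(1,1;1−β_j)`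
(the divisor pairs of `q^e` are `(q^a, q^{e−a})`; the only prime factor of `q^e` is `q`).
[cite: Zhang2022LandauSiegel, §16 p.93] -/
theorem varpi2loc_prime_pow {q : ℕ} (hq : q.Prime) {e : ℕ} (he : e ≠ 0) (j : ℕ) :
    varpi2loc c' χ j (q ^ e) =
      ∑ a ∈ Finset.range (e + 1), lam2 c' χ (q ^ a) 1 * ((q ^ a : ℕ) : ℂ) ^ betaJ c' D j *
        χ (q : ZMod D) ^ (e - a) * locRatio c' χ q (q ^ a) (q ^ (e - a)) (1 - betaJ c' D j) := by
  unfold varpi2loc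
  rw [Nat.primeFactors_prime_pow he hq, Nat.sum_divisorsAntidiagonal (fun a b =>
      lam2 c' χ a 1 * (a : ℂ) ^ betaJ c' D j * χ (b : ZMod D) * ∏ p ∈ ({q} : Finset ℕ), locRatio c' χ p a b _),
    Nat.divisors_prime_pow hq, Finset.sum_map]
  refine Finset.sum_congr rfl fun a ha => ?_
  have ha' : a ≤ e := Nat.lt_succ_iff.mp (Finset.mem_range.mp ha)
  simp only [Function.Embedding.coeFn_mk, Finset.prod_singleton]
  rw [Nat.pow_div ha' hq.pos, Nat.cast_pow, Nat.cast_pow, map_pow]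

omit [NeZero D] in
/-- `‖(q^a)^{β_j}‖ = 1` (`Re β_j = 0`). [cite: Zhang2022LandauSiegel, §2 (2.13)] -/
theorem norm_prime_pow_cpow_betaJ {q : ℕ} (hq : q.Prime) (a j : ℕ) :
    ‖((q ^ a : ℕ) : ℂ) ^ betaJ c' D j‖ = 1 := by
  rw [Complex.norm_natCast_cpow_of_pos (pow_pos hq.pos a), betaJ_re_eq_zero, Real.rpow_zero]

/-- **`‖ϖ₂ⱼ^loc(q^e)‖ ≤ 2100(e+1)`** whenever `‖F_q(1,1;1−β_j)‖ ≥ 1/2` (each of the `e+1` summands has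
`|λ₂| ≤ 3`, unimodular `q^{aβ_j}`, `|χ| ≤ 1` and `|F_q(q^a,q^b)/F_q(1,1)| ≤ 350/(1/2)`).
[cite: Zhang2022LandauSiegel, §16 p.93] -/
theorem norm_varpi2loc_prime_pow_le {q : ℕ} (hq : q.Prime) (e j : ℕ)
    (hF : 1 / 2 ≤ ‖calM2Factor c' χ q 1 1 (1 - betaJ c' D j)‖) :
    ‖varpi2loc c' χ j (q ^ e)‖ ≤ 2100 * ((e : ℝ) + 1) := by
  rcases Nat.eq_zero_or_pos e with rfl | he
  · rw [pow_zero, varpi2loc_one]; simp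
  rw [varpi2loc_prime_pow c' χ hq he.ne' j]
  have hs : 9 / 10 ≤ (1 - betaJ c' D j).re := by rw [one_sub_betaJ_re]; norm_num
  have hterm : ∀ a ∈ Finset.range (e + 1),
      ‖lam2 c' χ (q ^ a) 1 * ((q ^ a : ℕ) : ℂ) ^ betaJ c' D j * χ (q : ZMod D) ^ (e - a) *
          locRatio c' χ q (q ^ a) (q ^ (e - a)) (1 - betaJ c' D j)‖ ≤ 2100 := by
    intro a _
    have h1 : ‖lam2 c' χ (q ^ a) 1‖ ≤ 3 := by
      rw [lam2_prime_pow c' χ hq a]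
      split_ifs
      · rw [norm_one]; norm_num
      · exact Typed.Section16ACalM2.norm_lam2_prime_one_le c' χ hq
    have h2 := norm_prime_pow_cpow_betaJ c' (D := D) hq a j
    have h3 : ‖χ (q : ZMod D) ^ (e - a)‖ ≤ 1 := by
      rw [norm_pow]; exact pow_le_one₀ (norm_nonneg _) (χ.norm_le_one _)
    have h4 : ‖locRatio c' χ q (q ^ a) (q ^ (e - a)) (1 - betaJ c' D j)‖ ≤ 700 := by
      unfold locRatio
      rw [norm_div, div_le_iff₀ (by linarith)]
      calc _ ≤ (350 : ℝ) := norm_calM2Factor_le c' χ hq _ _ hs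
        _ ≤ 700 * ‖calM2Factor c' χ q 1 1 (1 - betaJ c' D j)‖ := by linarith
    rw [norm_mul, norm_mul, norm_mul, h2, mul_one]
    calc ‖lam2 c' χ (q ^ a) 1‖ * ‖χ (q : ZMod D) ^ (e - a)‖ *
          ‖locRatio c' χ q (q ^ a) (q ^ (e - a)) (1 - betaJ c' D j)‖ ≤ 3 * 1 * 700 := by gcongr
      _ = 2100 := by norm_num
  calc _ ≤ ∑ a ∈ Finset.range (e + 1), ‖lam2 c' χ (q ^ a) 1 * ((q ^ a : ℕ) : ℂ) ^ betaJ c' D j *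
        χ (q : ZMod D) ^ (e - a) * locRatio c' χ q (q ^ a) (q ^ (e - a)) (1 - betaJ c' D j)‖ := norm_sum_le _ _
    _ ≤ ∑ a ∈ Finset.range (e + 1), (2100 : ℝ) := Finset.sum_le_sum hterm
    _ = 2100 * ((e : ℝ) + 1) := by simp; ring

end VarpiLoc

end Literature.NumberTheory.LFunctions.Zhang2022.Lemma162R

end
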